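import Summits.QuantumFields.YangMills.Theorems.BalabanUVNodesN12DirectSurjHsurjProxiesPrelim
import HarnessLib

/-!
# BalabanUVNodes ∕ N12 — (P4)′ WITHOUT THE GLOBAL GUARD: the right inverse of the chart derivative at a (2.12) minimiser from GUARDED PROXIES — one per constrained bond (differentiability) and
# one per inner site (row bound, curved site block) — instead of `SmallBelow … k U₀` down the whole torus (LOCATED-HSB repair pen ρ5c-(P4)′, dag-n12-c g21 census D4′)

Cell `pub-ymgap` (HUMAN RULINGS D-0062 ∕ D-0149), WIDTH SEAT `pub-ymgap-dag-n12-w6` g7 (node N12 = [B15]; key K1⁹ `stmt-QuantumFields-27364`, `--kind proof --supports … --as helper`;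
count-neutral).  THEOREMS ONLY (0 `def`, 0 `instance`, 0 `sorry`).  The proof is g6's p664681 `N12DirectSurjHsurj.exists_rightInverse_letter` with every use of the guard routed through a
proxy (`…HsurjProxiesPrelim`): differentiability of the chart from the per-bond proxies; the row bound (`exists_rowBound`) and the curved site block (`exists_curved_siteBlock`) APPLIED AT THE
SITE PROXY IN ITS OWN FIBRE and transferred back component-wise (`fderiv_msChart_apply_eq_of_sharpProxy`; the box gauge of `U₀` is as flat on the proxy); the footprint from differentiability
(`fderiv_msChart_apply_eq_zero_of_siteSupport'`).  Level-`0` rows, ranks, p660274's back-substitution and the letter `B` are untouched.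
DISPLAYED instead of `hsb` (both produced from the class by the lane's ρ5b `…TowerProxiesOfClass.exists_boxProxy_of_mem_class`): `hprox : ∀ i, ∃ U′, (U′ = U₀ on feeds j_i c_i) ∧ SmallBelow k U′`
(dag-n12-c's ρ5a text verbatim) and `hproxSite : ∀ j ∈ [1,k], ∀ inner y, ∃ U′, (U′ = U₀ on the sharp towers of the rows touching y) ∧ SmallBelow k U′`.
★★★ `exists_rightInverse_letter_of_proxies` — p664681's statement with that one substitution (same `ε`, same `B`).

HONEST FRAMING.  Bookkeeping by name over landed kernel theorems; per-height ∕ per-instance EXISTENCE constants (print's (46)∕(83) volume-uniform `O(1)` NOT claimed); the proxies and the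
box plaquette letter are HYPOTHESES; nothing of Bałaban's asserted; N12 NOT discharged; K1⁹ NOT closed; count-neutral (typed 28∕28 unmoved); R4 closes only the conditional finite-`𝕋⁴`
rung `BalabanLadder.UV`; no summit statement is proved here and NOT the Yang–Mills mass gap (Clay); nothing continuum ∕ ℝ⁴ ∕ OS.
-/

noncomputable section

open scoped BigOperators Matrix.Norms.L2Operator Topology NNReal
open Filter

namespace Summit.QuantumFields.YangMills.BalabanUVNodes.N12DirectSurjHsurjProxies

open Literature.MathematicalPhysics.QuantumFieldTheory.Balaban1983to89
open Node00 B15DeterminingSets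
open T4Continuum (T4Family)
open BlockAveragingEMLLinearised (linAvg)
open T4AdjointCovarianceUnitary (lieSU)
open B14.Eq213DetSet (Bj maxDomT Bj_of_gt)
open B14.Eq213MaximalDomains (side)
open B14.Eq216Concrete (feeds)
open B5Eq118OneStroke (iterBlockOf)
open B15Eq112TorusCover (lift)
open T4AxialGaugeSmallField (boxPlaqs)
open B16Ineq19NearFlatSliceNorms (opNorm_coe_le_norm_lieSU)
open Summit.QuantumFields.YangMills.BalabanUVNodes.N12DirectSurjTriangular (exists_rightInverse_bound_of_rankwise)
open Summit.QuantumFields.YangMills.BalabanUVNodes.N12DirectSurjSiteBlockFlat (exists_flat_siteBlock)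
open Summit.QuantumFields.YangMills.BalabanUVNodes.N12DirectSurjSiteBlockCurved (exists_rowBound exists_curved_siteBlock)
open Summit.QuantumFields.YangMills.BalabanUVNodes.N12DirectSurjBoxGauge (exists_boxGauge)
open Summit.QuantumFields.YangMills.BalabanUVNodes.N12DirectSurjHsurjPrelim
open Summit.QuantumFields.YangMills.BalabanUVNodes.N12DirectSurjHsurjProxiesPrelim

section Record

variable {F : T4Family} {N : ℕ} [NeZero N] {K k : ℕ}

set_option maxHeartbeats 400000 in
/-- ★★★ **(P4)′ WITHOUT THE GLOBAL GUARD — A RIGHT INVERSE OF THE CHART DERIVATIVE AT A MINIMISER WITH GUARDED PROXIES ONLY.**  g6's `exists_rightInverse_letter` (p664681) VERBATIM except that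
the global small-field letter `SmallBelow (avOfRecord F N K) k U₀` is REPLACED by two PROXY letters (LOCATED-HSB, dag-n12-c g21's census D4′, produced from the (2.12) class by the lane's ρ5b
`…TowerProxiesOfClass`): `hprox` — one guarded proxy per constrained bond agreeing with `U₀` on its tower `feeds j_i c_i` (the lane's ρ5a shape; gives the differentiability of `Ψ_{𝐁,W,U₀}`) — and
`hproxSite` — one guarded proxy per INNER `j`-site `y` agreeing with `U₀` on the sharp towers of all rows touching `y` (the 3^d-block box; feeds the row bound and the curved site block).  Same
`ε`, same `B`, same conclusion `DΨ_{𝐁_k(Z),W,U₀}(0) ∘ H = id`, `√(Σ_b ‖H v b‖²) ≤ B‖v‖`.  Proof = p664681's, every use of the guard routed through a proxy in its own fibre (`…HsurjProxiesPrelim`).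
[cite: Balaban1985Variational, (83) p.290, (44)-(47) p.285, (153) p.301; Balaban1988Convergent, (2.2) p.255, (2.11)-(2.13) pp.256-257; Balaban1987RG1, (0.4) p.253] -/
theorem exists_rightInverse_letter_of_proxies (hkK : k + 1 ≤ (F.P K).m + (F.P K).K) :
    ∃ ε : ℝ, 0 < ε ∧ ∀ (M₁ : ℕ) (_ : 1 ≤ M₁) (Z : Set (Site (F.P K) 0)) (_ : side (F.P K).L M₁ k ∣ (F.P K).sitesPerDir 0),
      ∃ B : ℝ, 0 ≤ B ∧ ∀ (W : MSField (F.P K) (SU N)) (U₀ : GaugeField (F.P K) 0 (SU N)),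
        AgreeOn (Bj M₁ Z k) (avgFamily (avOfRecord F N K) U₀) W →
        (∀ i : Fin (constrCard (Bj M₁ Z k) k), ∃ U' : GaugeField (F.P K) 0 (SU N),
          (∀ b ∈ feeds (((constrEnum (Bj M₁ Z k) k).symm i).1 : ℕ) ((constrEnum (Bj M₁ Z k) k).symm i).2.1, U' b = U₀ b) ∧ SmallBelow (avOfRecord F N K) k U') →
        (∀ (j : ℕ), 1 ≤ j → j ≤ k → ∀ y : Site (F.P K) j, embIter j y ∈ maxDomT M₁ Z j → ∃ U' : GaugeField (F.P K) 0 (SU N),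
          (∀ c : PBond (F.P K) j, (c.src = y ∨ c.tgt = y) → ∀ b₀ : PBond (F.P K) 0,
            (iterBlockOf j b₀.src = c.src ∨ iterBlockOf j b₀.src = c.tgt) → (iterBlockOf j b₀.tgt = c.src ∨ iterBlockOf j b₀.tgt = c.tgt) → U' b₀ = U₀ b₀) ∧
          SmallBelow (avOfRecord F N K) k U') →
        (∀ (j : ℕ), 1 ≤ j → j ≤ k → ∀ y : Site (F.P K) j, embIter j y ∈ maxDomT M₁ Z j →
          PlaqSmallOn (boxPlaqs (P := F.P K) (j := 0)
            (fun κ => lift (F.P K) (embIter j y) κ - ((((F.P K).L ^ j : ℕ) : ℤ) + ((((F.P K).L ^ j - 1) / 2 : ℕ) : ℤ)))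
            (fun κ => lift (F.P K) (embIter j y) κ + ((((F.P K).L ^ j : ℕ) : ℤ) + ((((F.P K).L ^ j - 1) / 2 : ℕ) : ℤ)))) ε U₀) →
        ∃ H : (Fin (constrCard (Bj M₁ Z k) k) → lieSU (Fin N)) → PBond (F.P K) 0 → lieSU (Fin N),
          (∀ v, fderiv ℝ (msChart F N K k (Bj M₁ Z k) W U₀) 0 (H v) = v) ∧
          ∀ v, Real.sqrt (∑ b, ‖H v b‖ ^ 2) ≤ B * ‖v‖ := by
  classical
  have hk : k ≤ (F.P K).m + (F.P K).K := Nat.le_of_succ_le hkK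
  obtain ⟨Q, hQ0, hQs⟩ : ∃ Q : (i : ℕ) → (PBond (F.P K) 0 → Matrix (Fin N) (Fin N) ℂ) → PBond (F.P K) i → Matrix (Fin N) (Fin N) ℂ,
      (∀ Y, Q 0 Y = Y) ∧ ∀ (i : ℕ) (Y : PBond (F.P K) 0 → Matrix (Fin N) (Fin N) ℂ) (c : PBond (F.P K) (i + 1)), Q (i + 1) Y c = linAvg (Q i Y) c :=
    ⟨fun i => Nat.rec (motive := fun i => (PBond (F.P K) 0 → Matrix (Fin N) (Fin N) ℂ) → PBond (F.P K) i → Matrix (Fin N) (Fin N) ℂ) (fun Y => Y)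
      (fun _ Qi Y c => linAvg (Qi Y) c) i, fun _ => rfl, fun _ _ _ => rfl⟩
  set Cp : ℝ := (Fintype.card (PBond (F.P K) 0) : ℝ) with hCp_def
  have hCp : 0 ≤ Cp := Nat.cast_nonneg _
  let p : Seminorm ℝ (PBond (F.P K) 0 → lieSU (Fin N)) := (Fintype.card (PBond (F.P K) 0) : ℝ≥0) • normSeminorm ℝ (PBond (F.P K) 0 → lieSU (Fin N))
  have hpY : ∀ Y, p Y = Cp * ‖Y‖ := fun Y => by
    show ((Fintype.card (PBond (F.P K) 0) : ℝ≥0) • normSeminorm ℝ (PBond (F.P K) 0 → lieSU (Fin N))) Y = _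
    rw [hCp_def]; simp [NNReal.smul_def]
  have hp : ∀ Y : PBond (F.P K) 0 → lieSU (Fin N), ∑ b, ‖(Y b : Matrix (Fin N) (Fin N) ℂ)‖ ^ 2 ≤ p Y ^ 2 := fun Y => by
    have h1 : ∀ b, ‖(Y b : Matrix (Fin N) (Fin N) ℂ)‖ ^ 2 ≤ ‖Y‖ ^ 2 := fun b =>
      pow_le_pow_left₀ (norm_nonneg _) ((opNorm_coe_le_norm_lieSU (Y b)).trans (norm_le_pi_norm Y b)) 2
    have hc : Cp ≤ Cp ^ 2 := by
      rcases Nat.eq_zero_or_pos (Fintype.card (PBond (F.P K) 0)) with h | h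
      · simp [hCp_def, h]
      · have : (1 : ℝ) ≤ Cp := by rw [hCp_def]; exact_mod_cast h
        nlinarith
    calc ∑ b, ‖(Y b : Matrix (Fin N) (Fin N) ℂ)‖ ^ 2 ≤ ∑ _b : PBond (F.P K) 0, ‖Y‖ ^ 2 := Finset.sum_le_sum fun b _ => h1 b
      _ = Cp * ‖Y‖ ^ 2 := by rw [Finset.sum_const, Finset.card_univ, nsmul_eq_mul]
      _ ≤ Cp ^ 2 * ‖Y‖ ^ 2 := mul_le_mul_of_nonneg_right hc (sq_nonneg _)
      _ = p Y ^ 2 := by rw [hpY, mul_pow]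
  have hpn : ∀ Y, p Y ≤ Cp * ‖Y‖ := fun Y => (hpY Y).le
  obtain ⟨C₁, ρ₁, hC₁, hρ₁, hRB⟩ := exists_rowBound (F := F) (N := N) (K := K) k Q hQ0 hQs p hp hCp hpn
  obtain ⟨C₂, ρ₂, hC₂, hρ₂, hblk⟩ := exists_curved_siteBlock (F := F) (N := N) (K := K) k Q hQ0 hQs p hp hCp hpn
  have hfl : ∀ (n : ℕ) (y : Site (F.P K) (n + 1)), ∃ (Φ : (PBond (F.P K) (n + 1) → lieSU (Fin N)) →ₗ[ℝ] (PBond (F.P K) 0 → lieSU (Fin N))) (C : ℝ),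
      0 ≤ C ∧ (∀ v, ‖Φ v‖ ≤ C * ‖v‖) ∧ (n + 1 ≤ (F.P K).m + (F.P K).K →
        (∀ (v : PBond (F.P K) (n + 1) → lieSU (Fin N)) (c : PBond (F.P K) (n + 1)), (c.src = y ∨ c.tgt = y) →
            Q (n + 1) (fun b => (Φ v b : Matrix (Fin N) (Fin N) ℂ)) c = (v c : Matrix (Fin N) (Fin N) ℂ)) ∧
        (∀ v (b : PBond (F.P K) 0), Φ v b ≠ 0 → iterBlockOf (n + 1) b.src = y ∧ iterBlockOf (n + 1) b.tgt = y ∧ iterBlockOf n b.src ≠ iterBlockOf n b.tgt)) := by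
    intro n y
    by_cases h : n + 1 ≤ (F.P K).m + (F.P K).K
    · obtain ⟨Φ, hQ, hsupp, C, hC, hCn⟩ := exists_flat_siteBlock (N := N) h y
      exact ⟨Φ, C, hC, hCn, fun _ => ⟨fun v c hc => hQ Q hQ0 hQs v c hc, hsupp⟩⟩
    · exact ⟨0, 0, le_rfl, fun v => by simp, fun h' => absurd h' h⟩
  choose Φf CΦf hCΦf0 hCΦfn hΦprops using hfl
  set CΦ : ℝ := 1 + ∑ σ : (i : Fin k) × Site (F.P K) ((i : ℕ) + 1), CΦf σ.1 σ.2 with hCΦ_def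
  have hCΦsum : 0 ≤ ∑ σ : (i : Fin k) × Site (F.P K) ((i : ℕ) + 1), CΦf σ.1 σ.2 := Finset.sum_nonneg fun σ _ => hCΦf0 _ _
  have hCΦ1 : 1 ≤ CΦ := by rw [hCΦ_def]; linarith
  have hCΦ0 : 0 ≤ CΦ := zero_le_one.trans hCΦ1
  have hCΦle : ∀ (n : ℕ) (hn : n < k) (y : Site (F.P K) (n + 1)), CΦf n y ≤ CΦ := fun n hn y => by
    have h := Finset.single_le_sum (f := fun σ : (i : Fin k) × Site (F.P K) ((i : ℕ) + 1) => CΦf σ.1 σ.2) (fun σ _ => hCΦf0 _ _)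
      (Finset.mem_univ (⟨⟨n, hn⟩, y⟩ : (i : Fin k) × Site (F.P K) ((i : ℕ) + 1)))
    rw [hCΦ_def]
    exact le_trans h (by linarith)
  set D : ℝ := (((F.P K).d - 1 : ℕ) : ℝ) * ((2 * ((F.P K).L ^ k + ((F.P K).L ^ k - 1) / 2) : ℕ) : ℝ) with hD_def
  have hD0 : 0 ≤ D := mul_nonneg (Nat.cast_nonneg _) (Nat.cast_nonneg _)
  have hDj : ∀ j ≤ k, (((F.P K).d - 1 : ℕ) : ℝ) * ((2 * ((F.P K).L ^ j + ((F.P K).L ^ j - 1) / 2) : ℕ) : ℝ) ≤ D := fun j hj => by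
    rw [hD_def]
    refine mul_le_mul_of_nonneg_left ?_ (Nat.cast_nonneg _)
    have h1 : (F.P K).L ^ j ≤ (F.P K).L ^ k := Nat.pow_le_pow_right (F.P K).L_pos hj
    have h2 : ((F.P K).L ^ j - 1) / 2 ≤ ((F.P K).L ^ k - 1) / 2 := Nat.div_le_div_right (by omega)
    exact_mod_cast (by omega : 2 * ((F.P K).L ^ j + ((F.P K).L ^ j - 1) / 2) ≤ 2 * ((F.P K).L ^ k + ((F.P K).L ^ k - 1) / 2))
  set ρ : ℝ := min ρ₁ ρ₂ with hρ_def
  have hρ : 0 < ρ := lt_min hρ₁ hρ₂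
  set Pd : ℝ := 4 * (D + 1) * ((C₂ + 1) * (Cp * CΦ + 1) * (ρ + 1)) with hPd_def
  have hge1 : 1 ≤ (C₂ + 1) * (Cp * CΦ + 1) * (ρ + 1) :=
    one_le_mul_of_one_le_of_one_le (one_le_mul_of_one_le_of_one_le (by linarith) (by nlinarith)) (by linarith)
  have hPd : 4 * (D + 1) ≤ Pd := by
    rw [hPd_def]; exact le_mul_of_one_le_right (by linarith) hge1
  have hPd0 : 0 < Pd := lt_of_lt_of_le (by linarith) hPd
  set ε : ℝ := ρ / Pd with hε_def
  have hε : 0 < ε := div_pos hρ hPd0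
  have hDε : D * ε < ρ := by
    rw [hε_def, ← mul_div_assoc, div_lt_iff₀ hPd0]
    nlinarith
  have hDεC : C₂ * (D * ε) * (Cp * CΦ) ≤ 1 / 2 := by
    have h1 : C₂ * (D * ε) * (Cp * CΦ) = (C₂ * D * ρ * (Cp * CΦ)) / Pd := by rw [hε_def]; ring
    rw [h1, div_le_iff₀ hPd0, hPd_def]
    have hM0 : 0 ≤ Cp * CΦ := mul_nonneg hCp hCΦ0
    have h2 : C₂ * D * ρ * (Cp * CΦ) ≤ (C₂ + 1) * (D + 1) * (ρ + 1) * (Cp * CΦ + 1) :=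
      mul_le_mul (mul_le_mul (mul_le_mul (by linarith) (by linarith) hD0 (by linarith)) (by linarith) hρ.le
        (mul_nonneg (by linarith) (by linarith))) (by linarith) hM0 (mul_nonneg (mul_nonneg (by linarith) (by linarith)) (by linarith))
    nlinarith
  refine ⟨ε, hε, fun M₁ hM1 Z hdiv => ?_⟩
  have h𝔹 : ∀ j, k < j → Bj M₁ Z k j = ∅ := fun j hj => Bj_of_gt hj
  set Smax : ℕ := ∑ j ∈ Finset.range (k + 1), Fintype.card (Site (F.P K) j) with hSmax_def
  have hS : ∀ j ≤ k, Fintype.card (Site (F.P K) j) ≤ Smax := fun j hj =>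
    Finset.single_le_sum (f := fun j => Fintype.card (Site (F.P K) j)) (fun _ _ => Nat.zero_le _) (Finset.mem_range.2 (Nat.lt_succ_of_le hj))
  obtain ⟨φ, hφlt, hφinj⟩ : ∃ φ : (j : ℕ) → Site (F.P K) j → ℕ, (∀ j y, φ j y < Fintype.card (Site (F.P K) j)) ∧ ∀ j, Function.Injective (φ j) :=
    ⟨fun j y => (Fintype.equivFin (Site (F.P K) j) y : ℕ), fun j y => (Fintype.equivFin _ y).isLt,
      fun j y y' h => (Fintype.equivFin _).injective (Fin.ext h)⟩
  let inner : (j : ℕ) → Site (F.P K) j → Prop := fun j y => embIter j y ∈ maxDomT M₁ Z j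
  have hhost := fun j => exists_host (inner j) (φ j)
  choose hostF hostF_mem hostF_inner hostF_max using hhost
  let host : (j : ℕ) → PBond (F.P K) j → Site (F.P K) j := fun j c => hostF j c.src c.tgt
  have host_mem : ∀ j (c : PBond (F.P K) j), host j c = c.src ∨ host j c = c.tgt := fun j c => hostF_mem j c.src c.tgt
  have host_inner : ∀ j (c : PBond (F.P K) j), (inner j c.src ∨ inner j c.tgt) → inner j (host j c) := fun j c h => hostF_inner j c.src c.tgt h
  have host_max : ∀ j (c : PBond (F.P K) j) (y : Site (F.P K) j), inner j y → (c.src = y ∨ c.tgt = y) → φ j y ≤ φ j (host j c) :=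
    fun j c y hy h => hostF_max j c.src c.tgt y hy h
  let code : (j : ℕ) → Site (F.P K) j → ℕ := fun j y => 1 + j * Smax + φ j y
  have code_def : ∀ j (y : Site (F.P K) j), code j y = 1 + j * Smax + φ j y := fun _ _ => rfl
  have code_pos : ∀ j (y : Site (F.P K) j), 0 < code j y := fun j y => by rw [code_def]; omega
  have code_lt : ∀ (j j' : ℕ) (y : Site (F.P K) j) (y' : Site (F.P K) j'), j ≤ k → j < j' → code j y < code j' y' := fun j j' y y' hj hjj' => by
    rw [code_def, code_def]
    have h1 : φ j y < Smax := lt_of_lt_of_le (hφlt j y) (hS j hj)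
    have h2 : (j + 1) * Smax ≤ j' * Smax := Nat.mul_le_mul_right _ hjj'
    have h3 : (j + 1) * Smax = j * Smax + Smax := by ring
    omega
  have code_le_of_lt : ∀ (j j' : ℕ) (y : Site (F.P K) j) (y' : Site (F.P K) j'), j' ≤ k → code j y < code j' y' → j ≤ j' :=
    fun j j' y y' hj' h => by
      by_contra hlt
      exact absurd h (not_lt.2 (code_lt j' j y' y hj' (lt_of_not_ge hlt)).le)
  have code_eq : ∀ (j j' : ℕ) (y : Site (F.P K) j) (y' : Site (F.P K) j'), j ≤ k → j' ≤ k → code j y = code j' y' → j = j' :=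
    fun j j' y y' hj hj' h => by
      rcases lt_trichotomy j j' with hlt | heq | hgt
      · exact absurd h (code_lt j j' y y' hj hlt).ne
      · exact heq
      · exact absurd h.symm (code_lt j' j y' y hj' hgt).ne
  have code_inj : ∀ (j : ℕ) (y y' : Site (F.P K) j), code j y = code j y' → y = y' := fun j y y' h =>
    hφinj j (by rw [code_def, code_def] at h; omega)
  have code_lt_iff : ∀ (j : ℕ) (y y' : Site (F.P K) j), code j y < code j y' ↔ φ j y < φ j y' := fun j y y' => by
    rw [code_def, code_def]; omega
  have code_bound : ∀ (j : ℕ) (y : Site (F.P K) j), j ≤ k → code j y < 1 + k * Smax + Smax := fun j y hj => by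
    rw [code_def]
    have h1 : φ j y < Smax := lt_of_lt_of_le (hφlt j y) (hS j hj)
    have h2 : j * Smax ≤ k * Smax := Nat.mul_le_mul_right _ hj
    omega
  let rk : ConstrSet (Bj M₁ Z k) k → ℕ := fun s => if ((s.1 : ℕ)) = 0 then 0 else code s.1 (host s.1 s.2.1)
  obtain ⟨rank, hrank⟩ : ∃ rank : Fin (constrCard (Bj M₁ Z k) k) → ℕ, ∀ s, rank (constrEnum (Bj M₁ Z k) k s) = rk s :=
    ⟨fun i => rk ((constrEnum (Bj M₁ Z k) k).symm i), fun s => congrArg rk ((constrEnum (Bj M₁ Z k) k).symm_apply_apply s)⟩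
  have hrk : ∀ (j' : ℕ) (hj' : j' < k + 1) (c' : PBond (F.P K) j') (hc' : c' ∈ bondsOf (Bj M₁ Z k j')),
      rk ⟨⟨j', hj'⟩, c', hc'⟩ = if j' = 0 then 0 else code j' (host j' c') := fun _ _ _ _ => rfl
  obtain ⟨Λ₀, hΛ₀pos, hΛ₀⟩ := SemilinearMapClass.bound_of_continuous
    (fderiv ℝ (msChart F N K k (Bj M₁ Z k) (avgFamily (avOfRecord F N K) (1 : GaugeField (F.P K) 0 (SU N))) (1 : GaugeField (F.P K) 0 (SU N))) 0)
    (ContinuousLinearMap.continuous _)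
  set Λ : ℝ := Λ₀ + C₁ * ρ₁ * Cp + 1 with hΛ_def
  have hΛ1 : 1 ≤ Λ := by rw [hΛ_def]; nlinarith [mul_nonneg (mul_nonneg hC₁ hρ₁.le) hCp]
  have hΛ0 : 0 ≤ Λ := zero_le_one.trans hΛ1
  set β : ℝ := 1 + 2 * CΦ with hβ_def
  have hβ0 : 0 ≤ β := by rw [hβ_def]; linarith
  have hβ1 : 1 ≤ β := by rw [hβ_def]; linarith
  set Nr : ℕ := 1 + k * Smax + Smax with hNr_def
  refine ⟨Real.sqrt (Fintype.card (PBond (F.P K) 0)) * (β * Nr * (1 + Λ * β) ^ Nr),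
    mul_nonneg (Real.sqrt_nonneg _) (mul_nonneg (mul_nonneg hβ0 (Nat.cast_nonneg _)) (pow_nonneg (add_nonneg zero_le_one (mul_nonneg hΛ0 hβ0)) _)),
    fun W U₀ hU hprox hproxSite hplaq => ?_⟩
  have hΨ : DifferentiableAt ℝ (msChart F N K k (Bj M₁ Z k) W U₀) 0 := differentiableAt_msChart_of_towerProxies hk hU hprox
  -- (6) the box gauge at an inner site and the induced near-flatness on the sharp towers of the rows touching it
  have hgauge : ∀ (j : ℕ), 1 ≤ j → j ≤ k → ∀ y : Site (F.P K) j, inner j y →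
      ∃ u : GaugeTransf (F.P K) 0 (SU N), ∀ (c : PBond (F.P K) j), (c.src = y ∨ c.tgt = y) → ∀ b₀ : PBond (F.P K) 0,
        (iterBlockOf j b₀.src = c.src ∨ iterBlockOf j b₀.src = c.tgt) → (iterBlockOf j b₀.tgt = c.src ∨ iterBlockOf j b₀.tgt = c.tgt) →
        ‖((GaugeField.gaugeAct u U₀ b₀ : SU N) : Matrix (Fin N) (Fin N) ℂ) - 1‖ ≤ D * ε := by
    intro j hj1 hjk y hy
    obtain ⟨u, hu⟩ := exists_boxGauge (P := F.P K) (N := N) (hjk.trans hk) (three_mul_pow_lt_sitesPerDir hkK hjk) y U₀ hε.le (hplaq j hj1 hjk y hy)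
    exact ⟨u, fun c hc b₀ hs ht => (hu b₀ (near_of_endpoint c hc _ hs) (near_of_endpoint c hc _ ht)).trans
      (mul_le_mul_of_nonneg_right (hDj j hjk) hε.le)⟩
  have hDερ₁ : D * ε < ρ₁ := hDε.trans_le (min_le_left _ _)
  have hDερ₂ : D * ε < ρ₂ := hDε.trans_le (min_le_right _ _)
  have hDε0 : 0 ≤ D * ε := mul_nonneg hD0 hε.le
  -- (7) the linear map and its uniform bound
  set L : (PBond (F.P K) 0 → lieSU (Fin N)) →ₗ[ℝ] (Fin (constrCard (Bj M₁ Z k) k) → lieSU (Fin N)) :=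
    (fderiv ℝ (msChart F N K k (Bj M₁ Z k) W U₀) 0).toLinearMap with hL_def
  have hLapp : ∀ x i, L x i = fderiv ℝ (msChart F N K k (Bj M₁ Z k) W U₀) 0 x i := fun _ _ => rfl
  have hrow : ∀ (s : ConstrSet (Bj M₁ Z k) k) (x : PBond (F.P K) 0 → lieSU (Fin N)),
      ‖fderiv ℝ (msChart F N K k (Bj M₁ Z k) W U₀) 0 x (constrEnum (Bj M₁ Z k) k s)‖ ≤ Λ * ‖x‖ := by
    rintro ⟨⟨j', hj'⟩, c', hc'⟩ x
    have hj'k : j' ≤ k := Nat.lt_succ_iff.1 hj'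
    rcases Nat.eq_zero_or_pos j' with rfl | hpos
    · rw [fderiv_msChart_apply_levelZero hU hΨ c' hc' x]
      exact (norm_le_pi_norm x c').trans (le_mul_of_one_le_left (norm_nonneg _) hΛ1)
    · have hin : inner j' (host j' c') := host_inner j' c' (inner_endpoint_of_mem_bondsOf_Bj hpos hj'k hc')
      obtain ⟨u, hu⟩ := hgauge j' hpos hj'k (host j' c') hin
      have hcy : c'.src = host j' c' ∨ c'.tgt = host j' c' := (host_mem j' c').elim (fun h => Or.inl h.symm) (fun h => Or.inr h.symm)
      have hflat := hu c' hcy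
      -- the guarded proxy at the host site, in its own fibre
      obtain ⟨U', hag, hsb'⟩ := hproxSite j' hpos hj'k (host j' c') hin
      have hflat' : ∀ b₀ : PBond (F.P K) 0, (iterBlockOf j' b₀.src = c'.src ∨ iterBlockOf j' b₀.src = c'.tgt) →
          (iterBlockOf j' b₀.tgt = c'.src ∨ iterBlockOf j' b₀.tgt = c'.tgt) →
          ‖((GaugeField.gaugeAct u U' b₀ : SU N) : Matrix (Fin N) (Fin N) ℂ) - 1‖ ≤ D * ε := fun b₀ hs ht => by
        have e : GaugeField.gaugeAct u U' b₀ = GaugeField.gaugeAct u U₀ b₀ := by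
          show u b₀.src * U' b₀ * (u b₀.tgt)⁻¹ = u b₀.src * U₀ b₀ * (u b₀.tgt)⁻¹
          rw [hag c' hcy b₀ hs ht]
        rw [e]; exact hflat b₀ hs ht
      have h := hRB (Bj M₁ Z k) h𝔹 hk (avgFamily (avOfRecord F N K) U') U' (fun _ _ _ => rfl) hsb' (constrEnum (Bj M₁ Z k) k ⟨⟨j', hj'⟩, c', hc'⟩) u hDε0 hDερ₁
      rw [Equiv.symm_apply_apply] at h
      have htr := fderiv_msChart_apply_eq_of_sharpProxy hk hU hΨ hsb' (constrEnum (Bj M₁ Z k) k ⟨⟨j', hj'⟩, c', hc'⟩)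
        (by rw [Equiv.symm_apply_apply]; exact fun b₀ hs ht => hag c' hcy b₀ hs ht) x
      rw [htr]
      refine (h hflat' hΛ₀pos.le hΛ₀ x).trans (mul_le_mul_of_nonneg_right ?_ (norm_nonneg _))
      rw [hΛ_def]
      have : C₁ * (D * ε) * Cp ≤ C₁ * ρ₁ * Cp := mul_le_mul_of_nonneg_right (mul_le_mul_of_nonneg_left hDερ₁.le hC₁) hCp
      linarith
  have hLbound : ∀ x, ‖L x‖ ≤ Λ * ‖x‖ := fun x =>
    (pi_norm_le_iff_of_nonneg (mul_nonneg hΛ0 (norm_nonneg _))).2 fun i => by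
      obtain ⟨s, rfl⟩ := (constrEnum (Bj M₁ Z k) k).surjective i
      rw [hLapp]
      exact hrow s x
  have hNr : ∀ i, rank i < Nr := fun i => by
    obtain ⟨⟨⟨j', hj'⟩, c', hc'⟩, rfl⟩ := (constrEnum (Bj M₁ Z k) k).surjective i
    rw [hrank, hrk]
    split_ifs with h0
    · rw [hNr_def]; omega
    · exact code_bound j' _ (Nat.lt_succ_iff.1 hj')
  -- (8) rank-wise solvability
  have hsolv : ∀ (r : ℕ) (v : Fin (constrCard (Bj M₁ Z k) k) → lieSU (Fin N)), (∀ i, rank i ≠ r → v i = 0) →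
      ∃ x : PBond (F.P K) 0 → lieSU (Fin N), (∀ i, rank i = r → L x i = v i) ∧ (∀ i, rank i < r → L x i = 0) ∧ ‖x‖ ≤ β * ‖v‖ := by
    intro r v hv
    by_cases hex : ∃ (n : ℕ) (_ : n + 1 ≤ k) (y : Site (F.P K) (n + 1)), inner (n + 1) y ∧ code (n + 1) y = r
    · obtain ⟨n, hn, y, hy, hr⟩ := hex
      have hnK : n + 1 ≤ (F.P K).m + (F.P K).K := hn.trans hk
      obtain ⟨hΦQ, hΦsupp⟩ := hΦprops n y hnK
      obtain ⟨u, hu⟩ := hgauge (n + 1) (Nat.succ_pos n) hn y hy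
      -- the guarded proxy at the site, in its own fibre; the box gauge is as flat on it
      obtain ⟨U', hag, hsb'⟩ := hproxSite (n + 1) (Nat.succ_pos n) hn y hy
      have hu' : ∀ c : PBond (F.P K) (n + 1), (c.src = y ∨ c.tgt = y) → ∀ b₀ : PBond (F.P K) 0,
          (iterBlockOf (n + 1) b₀.src = c.src ∨ iterBlockOf (n + 1) b₀.src = c.tgt) → (iterBlockOf (n + 1) b₀.tgt = c.src ∨ iterBlockOf (n + 1) b₀.tgt = c.tgt) →
          ‖((GaugeField.gaugeAct u U' b₀ : SU N) : Matrix (Fin N) (Fin N) ℂ) - 1‖ ≤ D * ε := fun c hc b₀ hs ht => by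
        have e : GaugeField.gaugeAct u U' b₀ = GaugeField.gaugeAct u U₀ b₀ := by
          show u b₀.src * U' b₀ * (u b₀.tgt)⁻¹ = u b₀.src * U₀ b₀ * (u b₀.tgt)⁻¹
          rw [hag c hc b₀ hs ht]
        rw [e]; exact hu c hc b₀ hs ht
      -- the target on the rows at `y`
      obtain ⟨t, ht_def, htn⟩ : ∃ t : PBond (F.P K) (n + 1) → lieSU (Fin N),
          (∀ (c : PBond (F.P K) (n + 1)) (hc : c ∈ bondsOf (Bj M₁ Z k (n + 1))), t c = v (constrEnum (Bj M₁ Z k) k ⟨⟨n + 1, Nat.lt_succ_of_le hn⟩, c, hc⟩)) ∧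
          ‖t‖ ≤ ‖v‖ := by
        refine ⟨fun c => if h : c ∈ bondsOf (Bj M₁ Z k (n + 1)) then v (constrEnum (Bj M₁ Z k) k ⟨⟨n + 1, Nat.lt_succ_of_le hn⟩, c, h⟩) else 0,
          fun c hc => dif_pos hc, (pi_norm_le_iff_of_nonneg (norm_nonneg v)).2 fun c => ?_⟩
        dsimp only
        split_ifs with h
        · exact norm_le_pi_norm v _
        · rw [norm_zero]; exact norm_nonneg v
      obtain ⟨X, hXrows, hXsupp, hXn⟩ := hblk (Bj M₁ Z k) h𝔹 hk (avgFamily (avOfRecord F N K) U') U' (fun _ _ _ => rfl) hsb' hn y (Φf n y) hCΦ0 hΦQ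
        (fun w => (hCΦfn n y w).trans (mul_le_mul_of_nonneg_right (hCΦle n (Nat.lt_of_succ_le hn) y) (norm_nonneg _)))
        u hDε0 hDερ₂ hDεC hu' t
      have hXsupp' : ∀ b : PBond (F.P K) 0, X b ≠ 0 →
          iterBlockOf (n + 1) b.src = y ∧ iterBlockOf (n + 1) b.tgt = y ∧ iterBlockOf n b.src ≠ iterBlockOf n b.tgt := fun b hb => by
        obtain ⟨w, hw⟩ := hXsupp b hb
        exact hΦsupp w b hw
      have hinj : ∀ q q' : Site (F.P K) (n + 1), embIter (n + 1) q = embIter (n + 1) q' → q = q' := fun q q' h => by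
        rw [← iterBlockOf_embIter (n + 1) hnK q, h, iterBlockOf_embIter (n + 1) hnK q']
      refine ⟨X, fun i hi => ?_, fun i hi => ?_, hXn.trans ?_⟩
      · -- rows of rank `r`: exactly the rows hosted at `y`
        obtain ⟨⟨⟨j', hj'⟩, c', hc'⟩, rfl⟩ := (constrEnum (Bj M₁ Z k) k).surjective i
        rw [hrank, hrk] at hi
        rw [hLapp]
        split_ifs at hi with h0
        · exact absurd (hi.trans hr.symm) (code_pos _ y).ne
        · have hjn : j' = n + 1 := code_eq j' (n + 1) _ y (Nat.lt_succ_iff.1 hj') hn (hi.trans hr.symm)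
          subst hjn
          have hhost : host (n + 1) c' = y := code_inj _ _ _ (hi.trans hr.symm)
          have hcy : c'.src = y ∨ c'.tgt = y := by
            rcases host_mem (n + 1) c' with h | h
            · exact Or.inl (h.symm.trans hhost)
            · exact Or.inr (h.symm.trans hhost)
          rw [fderiv_msChart_apply_eq_of_sharpProxy hk hU hΨ hsb' (constrEnum (Bj M₁ Z k) k ⟨⟨n + 1, hj'⟩, c', hc'⟩)
            (by rw [Equiv.symm_apply_apply]; exact fun b₀ hs ht => hag c' hcy b₀ hs ht) X, hXrows c' hc' hcy, ht_def c' hc']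
      · -- rows of smaller rank: level `≤ n`, or level `n+1` not touching `y`
        obtain ⟨⟨⟨j', hj'⟩, c', hc'⟩, rfl⟩ := (constrEnum (Bj M₁ Z k) k).surjective i
        rw [hrank, hrk] at hi
        rw [hLapp]
        have hfp := fderiv_msChart_apply_eq_zero_of_siteSupport' (F := F) hM1 hdiv hk hΨ hn hy X hXsupp'
          (constrEnum (Bj M₁ Z k) k ⟨⟨j', hj'⟩, c', hc'⟩)
        rw [Equiv.symm_apply_apply] at hfp
        split_ifs at hi with h0
        · refine hfp (Or.inl ?_)
          show j' ≤ n
          omega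
        · rw [← hr] at hi
          have hle : j' ≤ n + 1 := code_le_of_lt j' (n + 1) _ y hn hi
          rcases hle.lt_or_eq with hlt | heq
          · refine hfp (Or.inl ?_)
            show j' ≤ n
            omega
          · subst heq
            have hlt' : φ (n + 1) (host (n + 1) c') < φ (n + 1) y := (code_lt_iff _ _ _).1 hi
            refine hfp (Or.inr ⟨rfl, fun hs => ?_, fun ht => ?_⟩)
            · have hs' : c'.src = y := hinj c'.src y hs
              have := host_max (n + 1) c' y hy (Or.inl hs')
              omega
            · have ht' : c'.tgt = y := hinj c'.tgt y ht
              have := host_max (n + 1) c' y hy (Or.inr ht')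
              omega
      · -- the letter
        rw [hβ_def]
        calc 2 * CΦ * ‖t‖ ≤ 2 * CΦ * ‖v‖ := mul_le_mul_of_nonneg_left htn (by linarith)
          _ ≤ (1 + 2 * CΦ) * ‖v‖ := mul_le_mul_of_nonneg_right (by linarith) (norm_nonneg v)
    · by_cases hr0 : r = 0
      · -- rank 0: the level-0 rows, hit by the identity placement
        subst hr0
        obtain ⟨x, hx_def, hxn⟩ : ∃ x : PBond (F.P K) 0 → lieSU (Fin N),
            (∀ (b : PBond (F.P K) 0) (hb : b ∈ bondsOf (Bj M₁ Z k 0)), x b = v (constrEnum (Bj M₁ Z k) k ⟨⟨0, Nat.succ_pos k⟩, b, hb⟩)) ∧ ‖x‖ ≤ ‖v‖ := by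
          refine ⟨fun b => if h : b ∈ bondsOf (Bj M₁ Z k 0) then v (constrEnum (Bj M₁ Z k) k ⟨⟨0, Nat.succ_pos k⟩, b, h⟩) else 0,
            fun b hb => dif_pos hb, (pi_norm_le_iff_of_nonneg (norm_nonneg v)).2 fun b => ?_⟩
          dsimp only
          split_ifs with h
          · exact norm_le_pi_norm v _
          · rw [norm_zero]; exact norm_nonneg v
        refine ⟨x, fun i hi => ?_, fun i hi => absurd hi (Nat.not_lt_zero _), hxn.trans (le_mul_of_one_le_left (norm_nonneg _) hβ1)⟩
        obtain ⟨⟨⟨j', hj'⟩, c', hc'⟩, rfl⟩ := (constrEnum (Bj M₁ Z k) k).surjective i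
        rw [hrank, hrk] at hi
        rw [hLapp]
        split_ifs at hi with h0
        · subst h0
          rw [fderiv_msChart_apply_levelZero hU hΨ c' hc' x, hx_def c' hc']
        · exact absurd hi (code_pos _ _).ne'
      · -- no row has rank `r`: `x = 0`
        refine ⟨0, fun i hi => ?_, fun i _ => by rw [map_zero]; rfl, by rw [norm_zero]; exact mul_nonneg hβ0 (norm_nonneg _)⟩
        exfalso
        obtain ⟨⟨⟨j', hj'⟩, c', hc'⟩, rfl⟩ := (constrEnum (Bj M₁ Z k) k).surjective i
        rw [hrank, hrk] at hi
        split_ifs at hi with h0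
        · exact hr0 hi.symm
        · have hj'k : j' ≤ k := Nat.lt_succ_iff.1 hj'
          have hpos : 1 ≤ j' := Nat.one_le_iff_ne_zero.2 h0
          obtain ⟨n, rfl⟩ : ∃ n, j' = n + 1 := ⟨j' - 1, by omega⟩
          exact hex ⟨n, hj'k, host (n + 1) c', host_inner _ c' (inner_endpoint_of_mem_bondsOf_Bj hpos hj'k hc'), hi⟩
  -- (9) back-substitution and the norm conversion
  obtain ⟨H, hHinv, hHB⟩ := exists_rightInverse_bound_of_rankwise L rank hNr hβ0 hΛ0 hLbound hsolv
  refine ⟨H, fun v => ?_, fun v => ?_⟩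
  · have h := hHinv v
    rwa [hL_def, ContinuousLinearMap.coe_coe] at h
  · calc Real.sqrt (∑ b, ‖H v b‖ ^ 2) ≤ Real.sqrt (Fintype.card (PBond (F.P K) 0)) * ‖H v‖ := sqrt_sum_sq_le (H v)
      _ ≤ Real.sqrt (Fintype.card (PBond (F.P K) 0)) * (β * Nr * (1 + Λ * β) ^ Nr * ‖v‖) :=
          mul_le_mul_of_nonneg_left (hHB v) (Real.sqrt_nonneg _)
      _ = Real.sqrt (Fintype.card (PBond (F.P K) 0)) * (β * Nr * (1 + Λ * β) ^ Nr) * ‖v‖ := by ring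

end Record

end Summit.QuantumFields.YangMills.BalabanUVNodes.N12DirectSurjHsurjProxies

end
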